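import Mathlib

/-!
# `Balaban1983to89.B12PartitionUnity270` — [Balaban1987RG1] p. 270: the smooth profile `ζ` and the partition of
unity `1 = Σ_□ ζ_□` of the cube cover, CONSTRUCTED; the printed derivative bound «bounded by 5» checked

HONEST FRAMING (cell `lit-balaban`, verbatim): statement-level skeleton of published theorems with citation tags; proofs where landed; nothing here is a claim about the Yang–Mills mass gap.

CITATION HEADER.  T. Bałaban, *Renormalization group approach to lattice gauge field theories. I. Generation of
effective actions in a small field approximation and a coupling constant renormalization in four dimensions*,
Commun. Math. Phys. **109** (1987) 249–301, doi:10.1007/bf01215223 [Balaban1987RG1] (cell paper B12; held text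
`paper:balaban1987-cmp109-rg-i-small-field`, journal page = PDF page + 248; the paragraph was read from the page
render `b2b-balaban-ref1/pages/1987-cmp109-rg-I-small-field/…-p022-x2.png` (p. 270)).  Unit `lit-balaban-r09` gen 2
(Phase 2), SKELETON row `B12.Def@270` (partial before this file: the cube geometry/cardinality
`B12Cubes436.card_cube`; the smooth profile and the partition of unity were not typed).

WHAT IS PRINTED (verbatim, p. 270).  *«Let us take the partition π_k. We construct a cover of the space T by cubes □,
which are unions of 2^d neighbouring cubes from π_k. For this cover we take a partition of unity 1 = Σ_□ ζ_□ with
smooth functions ζ_□. More exactly we assume that if y is a center of the cube □, then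
ζ_□(x) = Π_{μ=1}^d ζ(M⁻¹(x_μ − y_μ)), where ζ ∈ C₀^∞(R¹), ζ(t) = 1 for |t| ≦ 1/3, ζ(t) = 0 for |t| ≧ 2/3, ζ has
derivatives up to the second order bounded by 5. Let us recall that we consider the continuous space T and all the
cubes in the scale corresponding to the lattice T_η.»*

WHAT THIS MODULE CONSTRUCTS AND PROVES.
* `zeta` — a CONCRETE profile: `ζ(t) = s(t + 1/2) − s(t − 1/2)` with the smooth step
  `s(t) = Real.smoothTransition (3t + 1/2)` (`= 0` for `t ≤ −1/6`, `= 1` for `t ≥ 1/6`); PROVED: `ζ ∈ C^∞`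
  (`contDiff_zeta`), `ζ = 1` on `|t| ≤ 1/3` (`zeta_eq_one`), `ζ = 0` on `|t| ≥ 2/3` (`zeta_eq_zero`), compact support
  in `[−2/3, 2/3] ⊂ ]−1, 1[` (`tsupport_zeta_subset`, `hasCompactSupport_zeta`), `0 ≤ ζ ≤ 1`.
* THE PARTITION OF UNITY, one variable: `Σ_{n=−N}^{N} ζ(t − n) = 1` for `|t| ≤ N` (`sum_zeta_sub_int`,
  telescoping); `d` variables: with `ζ_□(x) = Π_μ ζ(M⁻¹(x_μ − y_μ))` (`zetaCube`) over the centres `y ∈ Mℤ^d`,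
  `Σ_{y} ζ_□(x) = 1` on `|x_μ| ≤ MN` (`sum_zetaCube_eq_one`) — the printed `1 = Σ_□ ζ_□` on every bounded region
  (cubes `□` of side `2M` centred at the points of `Mℤ^d` = unions of `2^d` neighbouring cubes of the `M`-lattice
  `π_k`).
* THE PRINTED BOUND «derivatives up to the second order bounded by 5» — LOCATED SLIP (harmless): for ANY `C²`
  function with `ζ = 1` on `|t| ≤ 1/3` and `ζ = 0` on `|t| ≥ 2/3` the second derivative satisfies
  `max_{[1/3,2/3]} |ζ″| ≥ 36` (`thirtySix_le_deriv2`: `ζ′(1/3) = ζ′(2/3) = 0`, `|ζ′(t)| ≤ A·dist(t, {1/3, 2/3})`,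
  `1 = |ζ(1/3) − ζ(2/3)| ≤ A/36`); hence no profile with the two printed plateaus has `|ζ″| ≤ 5`
  (`not_deriv2_le_five`).  The first derivative CAN be `≤ 5` (any monotone transition has `max|ζ′| ≥ 3` only); the
  paper uses the bound only as an `O(1)` constant in (3.11)–(3.13), (3.16) («O(1)» p. 272), so the slip does not
  propagate: replace 5 by any bound of the chosen profile (for `zeta` below we do not compute one).
Nothing of the series is asserted; no `Prop` fact; axioms standard.
-/

namespace Literature.MathematicalPhysics.QuantumFieldTheory.Balaban1983to89.B12PartitionUnity270

open Set Real MeasureTheory intervalIntegral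
open scoped Topology

noncomputable section

/-! ## 1. The profile `ζ` -/

/-- The smooth step `s(t) = smoothTransition(3t + 1/2)`: `0` for `t ≤ −1/6`, `1` for `t ≥ 1/6`, monotone, `C^∞`.
[cite: Balaban1987RG1, §3 p.270] -/
def step (t : ℝ) : ℝ := Real.smoothTransition (3 * t + 1 / 2)

/-- **The profile `ζ ∈ C₀^∞(ℝ)` of p. 270** (a concrete choice): `ζ(t) = s(t + 1/2) − s(t − 1/2)`.
[cite: Balaban1987RG1, §3 p.270] -/
def zeta (t : ℝ) : ℝ := step (t + 1 / 2) - step (t - 1 / 2)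

/-- `s(t) = 0` for `t ≤ −1/6`. [cite: Balaban1987RG1, §3 p.270] -/
theorem step_eq_zero {t : ℝ} (ht : t ≤ -(1 / 6)) : step t = 0 :=
  Real.smoothTransition.zero_of_nonpos (by linarith)

/-- `s(t) = 1` for `t ≥ 1/6`. [cite: Balaban1987RG1, §3 p.270] -/
theorem step_eq_one {t : ℝ} (ht : 1 / 6 ≤ t) : step t = 1 :=
  Real.smoothTransition.one_of_one_le (by linarith)

/-- `s` is monotone. [cite: Balaban1987RG1, §3 p.270] -/
theorem step_monotone : Monotone step := fun a b hab =>
  Real.smoothTransition.monotone (by linarith)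

/-- `s` is `C^n` for every `n`. [cite: Balaban1987RG1, §3 p.270] -/
theorem contDiff_step {n : ℕ∞} : ContDiff ℝ n step :=
  Real.smoothTransition.contDiff.comp ((contDiff_const.mul contDiff_id).add contDiff_const)

/-- **«ζ ∈ C₀^∞(R¹)»**, smoothness: `ζ` is `C^n` for every `n`. [cite: Balaban1987RG1, §3 p.270] -/
theorem contDiff_zeta {n : ℕ∞} : ContDiff ℝ n zeta :=
  (contDiff_step.comp (contDiff_id.add contDiff_const)).sub (contDiff_step.comp (contDiff_id.sub contDiff_const))

/-- **«ζ(t) = 1 for |t| ≦ 1/3»**. [cite: Balaban1987RG1, §3 p.270] -/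
theorem zeta_eq_one {t : ℝ} (ht : |t| ≤ 1 / 3) : zeta t = 1 := by
  obtain ⟨h1, h2⟩ := abs_le.mp ht
  unfold zeta
  rw [step_eq_one (by linarith), step_eq_zero (by linarith)]
  norm_num

/-- **«ζ(t) = 0 for |t| ≧ 2/3»**. [cite: Balaban1987RG1, §3 p.270] -/
theorem zeta_eq_zero {t : ℝ} (ht : 2 / 3 ≤ |t|) : zeta t = 0 := by
  unfold zeta
  rcases le_abs'.mp ht with h | h
  · rw [step_eq_zero (by linarith), step_eq_zero (by linarith)]; norm_num
  · rw [step_eq_one (by linarith), step_eq_one (by linarith)]; norm_num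

/-- `0 ≤ ζ`. [cite: Balaban1987RG1, §3 p.270] -/
theorem zeta_nonneg (t : ℝ) : 0 ≤ zeta t := by
  unfold zeta
  have := step_monotone (show t - 1 / 2 ≤ t + 1 / 2 by linarith)
  linarith

/-- `ζ ≤ 1`. [cite: Balaban1987RG1, §3 p.270] -/
theorem zeta_le_one (t : ℝ) : zeta t ≤ 1 := by
  unfold zeta step
  have h1 := Real.smoothTransition.le_one (3 * (t + 1 / 2) + 1 / 2)
  have h2 := Real.smoothTransition.nonneg (3 * (t - 1 / 2) + 1 / 2)
  linarith

/-- **«ζ ∈ C₀^∞(R¹)»**, support: `tsupport ζ ⊆ [−2/3, 2/3]` (`⊂ ]−1, 1[`). [cite: Balaban1987RG1, §3 p.270] -/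
theorem tsupport_zeta_subset : tsupport zeta ⊆ Icc (-(2 / 3)) (2 / 3) := by
  apply closure_minimal _ isClosed_Icc
  intro t ht
  rw [Function.mem_support] at ht
  by_contra h
  apply ht
  apply zeta_eq_zero
  rw [mem_Icc, not_and_or, not_le, not_le] at h
  rcases h with h | h
  · rw [abs_of_neg (by linarith)]; linarith
  · rw [abs_of_pos (by linarith)]; linarith

/-- **«ζ ∈ C₀^∞(R¹)»**, compact support. [cite: Balaban1987RG1, §3 p.270] -/
theorem hasCompactSupport_zeta : HasCompactSupport zeta :=
  HasCompactSupport.of_support_subset_isCompact isCompact_Icc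
    (subset_tsupport zeta |>.trans tsupport_zeta_subset)

/-! ## 2. The partition of unity `1 = Σ_□ ζ_□` -/

/-- Telescoping form of the integer translates: `Σ_{k<m} ζ(u − k) = s(u + 1/2) − s(u + 1/2 − m)`.
[cite: Balaban1987RG1, §3 p.270] -/
theorem sum_zeta_range (u : ℝ) (m : ℕ) :
    ∑ k ∈ Finset.range m, zeta (u - k) = step (u + 1 / 2) - step (u + 1 / 2 - m) := by
  induction m with
  | zero => simp
  | succ m ih =>
    rw [Finset.sum_range_succ, ih]
    unfold zeta
    push_cast
    ring_nf

/-- **The partition of unity in one variable**: `Σ_{n=−N}^{N} ζ(t − n) = 1` for `|t| ≤ N` (only the translates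
with `|t − n| < 2/3` contribute). [cite: Balaban1987RG1, §3 p.270] -/
theorem sum_zeta_sub_int (N : ℕ) {t : ℝ} (ht : |t| ≤ N) :
    ∑ n ∈ Finset.Icc (-(N : ℤ)) N, zeta (t - n) = 1 := by
  obtain ⟨h1, h2⟩ := abs_le.mp ht
  have himg : Finset.Icc (-(N : ℤ)) N = (Finset.range (2 * N + 1)).image (fun k : ℕ => (k : ℤ) - N) := by
    ext n
    simp only [Finset.mem_Icc, Finset.mem_image, Finset.mem_range]
    constructor
    · rintro ⟨hn1, hn2⟩
      exact ⟨(n + N).toNat, by omega, by omega⟩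
    · rintro ⟨k, hk, rfl⟩
      omega
  rw [himg, Finset.sum_image (by intro a _ b _ hab; simpa using hab)]
  have hsum : ∑ k ∈ Finset.range (2 * N + 1), zeta (t - (((k : ℤ) - N : ℤ) : ℝ))
      = ∑ k ∈ Finset.range (2 * N + 1), zeta (t + N - k) := by
    refine Finset.sum_congr rfl fun k _ => ?_
    push_cast
    ring_nf
  rw [hsum, sum_zeta_range (t + N) (2 * N + 1), step_eq_one (by linarith),
    step_eq_zero (by push_cast; linarith)]
  norm_num

/-- The cube functions of p. 270: `ζ_□(x) = Π_{μ=1}^d ζ(M⁻¹(x_μ − y_μ))` for the cube `□` of the cover centred at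
`y`. [cite: Balaban1987RG1, §3 p.270] -/
def zetaCube (d : ℕ) (M : ℝ) (y x : Fin d → ℝ) : ℝ := ∏ μ, zeta (M⁻¹ * (x μ - y μ))

/-- `0 ≤ ζ_□ ≤ 1`. [cite: Balaban1987RG1, §3 p.270] -/
theorem zetaCube_nonneg_le_one (d : ℕ) (M : ℝ) (y x : Fin d → ℝ) :
    0 ≤ zetaCube d M y x ∧ zetaCube d M y x ≤ 1 :=
  ⟨Finset.prod_nonneg fun _ _ => zeta_nonneg _,
    Finset.prod_le_one (fun _ _ => zeta_nonneg _) fun _ _ => zeta_le_one _⟩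

/-- `ζ_□(x) = 0` unless every coordinate of `x` is within `(2/3)M` of the centre: the support of `ζ_□` lies inside
the cube `□` of side `2M` (indeed inside `∏_μ ]y_μ − M, y_μ + M[`). [cite: Balaban1987RG1, §3 p.270] -/
theorem zetaCube_eq_zero {d : ℕ} {M : ℝ} (hM : 0 < M) {y x : Fin d → ℝ} {μ : Fin d}
    (h : 2 / 3 * M ≤ |x μ - y μ|) : zetaCube d M y x = 0 := by
  unfold zetaCube
  apply Finset.prod_eq_zero (Finset.mem_univ μ)
  apply zeta_eq_zero
  rw [abs_mul, abs_of_pos (inv_pos.2 hM)]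
  rw [le_inv_mul_iff₀ hM]
  linarith

/-- **The partition of unity `1 = Σ_□ ζ_□` of p. 270** on a bounded region: summing the cube functions over the
centres `y = Mn`, `n ∈ {−N, …, N}^d` (the cubes `□` of side `2M` centred at the points of the `M`-lattice `π_k`,
each a union of `2^d` neighbouring cubes of `π_k`), `Σ_□ ζ_□(x) = 1` whenever `|x_μ| ≤ MN` for all `μ`.
[cite: Balaban1987RG1, §3 p.270] -/
theorem sum_zetaCube_eq_one (d : ℕ) {M : ℝ} (hM : 0 < M) (N : ℕ) {x : Fin d → ℝ}
    (hx : ∀ μ, |x μ| ≤ M * N) :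
    ∑ n ∈ Fintype.piFinset (fun _ : Fin d => Finset.Icc (-(N : ℤ)) N),
      zetaCube d M (fun μ => M * n μ) x = 1 := by
  unfold zetaCube
  rw [← Finset.prod_univ_sum (fun _ : Fin d => Finset.Icc (-(N : ℤ)) N)
    (fun μ (n : ℤ) => zeta (M⁻¹ * (x μ - M * n)))]
  refine Finset.prod_eq_one fun μ _ => ?_
  have hM0 : M ≠ 0 := hM.ne'
  have hre : ∀ n : ℤ, M⁻¹ * (x μ - M * n) = M⁻¹ * x μ - n := fun n => by field_simp
  simp_rw [hre]
  apply sum_zeta_sub_int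
  rw [abs_mul, abs_of_pos (inv_pos.2 hM), inv_mul_le_iff₀ hM]
  exact hx μ

/-! ## 3. The printed bound «derivatives up to the second order bounded by 5»: the second derivative of ANY
admissible profile reaches 36 -/

/-- A `C¹` function constant (`= c`) on `[a, b]` (`a < b`) has derivative `0` at the right endpoint `b`
(one-sided uniqueness of the derivative on an interval). [cite: Balaban1987RG1, §3 p.270] -/
theorem deriv_eq_zero_of_const_Icc_right {f : ℝ → ℝ} (hf : Differentiable ℝ f) {a b c : ℝ} (hab : a < b)
    (h : ∀ t ∈ Icc a b, f t = c) : deriv f b = 0 := by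
  have hU : UniqueDiffWithinAt ℝ (Icc a b) b := uniqueDiffOn_Icc hab _ (right_mem_Icc.2 hab.le)
  have h1 : HasDerivWithinAt f (deriv f b) (Icc a b) b := (hf b).hasDerivAt.hasDerivWithinAt
  have h2 : HasDerivWithinAt f 0 (Icc a b) b :=
    (hasDerivWithinAt_const b (Icc a b) c).congr (fun t ht => h t ht) (h b (right_mem_Icc.2 hab.le))
  exact hU.eq_deriv _ h1 h2

/-- A `C¹` function constant (`= c`) on `[a, b]` (`a < b`) has derivative `0` at the left endpoint `a`.
[cite: Balaban1987RG1, §3 p.270] -/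
theorem deriv_eq_zero_of_const_Icc_left {f : ℝ → ℝ} (hf : Differentiable ℝ f) {a b c : ℝ} (hab : a < b)
    (h : ∀ t ∈ Icc a b, f t = c) : deriv f a = 0 := by
  have hU : UniqueDiffWithinAt ℝ (Icc a b) a := uniqueDiffOn_Icc hab _ (left_mem_Icc.2 hab.le)
  have h1 : HasDerivWithinAt f (deriv f a) (Icc a b) a := (hf a).hasDerivAt.hasDerivWithinAt
  have h2 : HasDerivWithinAt f 0 (Icc a b) a :=
    (hasDerivWithinAt_const a (Icc a b) c).congr (fun t ht => h t ht) (h a (left_mem_Icc.2 hab.le))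
  exact hU.eq_deriv _ h1 h2

/-- **The printed constant checked.**  For ANY `C²` function `f : ℝ → ℝ` with `f(t) = 1` for `|t| ≤ 1/3` and
`f(t) = 0` for `|t| ≥ 2/3`, the second derivative reaches `36` in absolute value somewhere on `[1/3, 2/3]`:
`f′(1/3) = f′(2/3) = 0` (plateaus), so if `|f″| ≤ A` there then `|f′(t)| ≤ A·min(t − 1/3, 2/3 − t)` and
`1 = f(1/3) − f(2/3) = −∫f′ ≤ A(1/72 + 1/72) = A/36`.  Hence «derivatives up to the second order bounded by 5»
(p. 270) cannot hold literally for the second derivative; the paper uses the bound only as an `O(1)`.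
[cite: Balaban1987RG1, §3 p.270] -/
theorem thirtySix_le_deriv2 (f : ℝ → ℝ) (hf : ContDiff ℝ 2 f) (h1 : ∀ t, |t| ≤ 1 / 3 → f t = 1)
    (h0 : ∀ t, 2 / 3 ≤ |t| → f t = 0) :
    ∃ t ∈ Icc (1 / 3 : ℝ) (2 / 3), 36 ≤ |deriv (deriv f) t| := by
  by_contra hcon
  simp only [not_exists, not_and, not_le] at hcon
  -- regularity
  have hf1 : Differentiable ℝ f := by
    have h := hf.differentiable_iteratedDeriv 0 (by norm_num)
    simpa using h
  have hf2 : Differentiable ℝ (deriv f) := by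
    have h := hf.differentiable_iteratedDeriv 1 (by norm_num)
    simpa [iteratedDeriv_one] using h
  have hcont : Continuous (deriv (deriv f)) := by
    have h := hf.continuous_iteratedDeriv 2 (by norm_num)
    simpa [iteratedDeriv_succ, iteratedDeriv_one] using h
  -- the maximum `A < 36` of `|f″|` on `[1/3, 2/3]`
  obtain ⟨t₀, ht₀, hmax⟩ := isCompact_Icc.exists_isMaxOn (nonempty_Icc.2 (by norm_num : (1 / 3 : ℝ) ≤ 2 / 3))
    (hcont.abs.continuousOn : ContinuousOn (fun t => |deriv (deriv f) t|) (Icc (1 / 3 : ℝ) (2 / 3)))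
  set A : ℝ := |deriv (deriv f) t₀| with hAdef
  have hA36 : A < 36 := hcon t₀ ht₀
  have hA0 : 0 ≤ A := abs_nonneg _
  have hbd : ∀ t ∈ Icc (1 / 3 : ℝ) (2 / 3), |deriv (deriv f) t| ≤ A := fun t ht => hmax ht
  -- plateaus: `f′(1/3) = f′(2/3) = 0`
  have hd13 : deriv f (1 / 3) = 0 :=
    deriv_eq_zero_of_const_Icc_right hf1 (by norm_num : (-(1 / 3) : ℝ) < 1 / 3)
      fun t ht => h1 t (abs_le.2 ⟨by linarith [ht.1], ht.2⟩)
  have hd23 : deriv f (2 / 3) = 0 :=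
    deriv_eq_zero_of_const_Icc_left hf1 (by norm_num : (2 / 3 : ℝ) < 1)
      fun t ht => h0 t (le_trans ht.1 (le_abs_self t))
  -- `|f′(t)| ≤ A (t − 1/3)` on `[1/3, 2/3]`
  have hleft : ∀ t ∈ Icc (1 / 3 : ℝ) (2 / 3), |deriv f t| ≤ A * (t - 1 / 3) := by
    have h := norm_image_sub_le_of_norm_deriv_le_segment' (f := deriv f) (f' := deriv (deriv f))
      (a := (1 / 3 : ℝ)) (b := 2 / 3) (C := A)
      (fun x _ => (hf2 x).hasDerivAt.hasDerivWithinAt)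
      (fun x hx => by
        rw [Real.norm_eq_abs]; exact hbd x (Ico_subset_Icc_self hx))
    intro t ht
    have := h t ht
    rwa [hd13, sub_zero, Real.norm_eq_abs] at this
  -- `|f′(t)| ≤ A (2/3 − t)` on `[1/3, 2/3]` (same bound anchored at the right end, via `x ↦ f′(1 − x)`)
  have hright : ∀ t ∈ Icc (1 / 3 : ℝ) (2 / 3), |deriv f t| ≤ A * (2 / 3 - t) := by
    have h := norm_image_sub_le_of_norm_deriv_le_segment' (f := fun x => deriv f (1 - x))
      (f' := fun x => deriv (deriv f) (1 - x) * (-1)) (a := (1 / 3 : ℝ)) (b := 2 / 3) (C := A)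
      (fun x _ => ((hf2 (1 - x)).hasDerivAt.comp x ((hasDerivAt_id x).const_sub 1)).hasDerivWithinAt)
      (fun x hx => by
        rw [norm_mul, norm_neg, norm_one, mul_one, Real.norm_eq_abs]
        exact hbd (1 - x) ⟨by linarith [hx.2], by linarith [hx.1]⟩)
    intro t ht
    have := h (1 - t) ⟨by linarith [ht.2], by linarith [ht.1]⟩
    rw [show (1 : ℝ) - 1 / 3 = 2 / 3 by norm_num, hd23, sub_zero, Real.norm_eq_abs,
      show (1 : ℝ) - (1 - t) = t by ring] at this
    linarith
  -- integrate: `f(2/3) − f(1/3) = ∫_{1/3}^{1/2} f′ + ∫_{1/2}^{2/3} f′`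
  have hcontd : Continuous (deriv f) := hf2.continuous
  have hint : ∀ a b : ℝ, IntervalIntegrable (deriv f) volume a b := fun a b =>
    hcontd.intervalIntegrable a b
  have hFTC : ∀ a b : ℝ, ∫ x in a..b, deriv f x = f b - f a := fun a b =>
    integral_eq_sub_of_hasDerivAt (fun x _ => (hf1 x).hasDerivAt) (hint a b)
  have hI1 : |∫ x in (1 / 3 : ℝ)..(1 / 2), deriv f x| ≤ A / 72 := by
    have h := intervalIntegral.norm_integral_le_of_norm_le (f := deriv f) (g := fun t => A * (t - 1 / 3))
      (μ := volume) (by norm_num : (1 / 3 : ℝ) ≤ 1 / 2)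
      (Filter.Eventually.of_forall fun t ht => by
        rw [Real.norm_eq_abs]; exact hleft t ⟨ht.1.le, by linarith [ht.2]⟩)
      ((continuous_const.mul (continuous_id.sub continuous_const)).intervalIntegrable _ _)
    rw [Real.norm_eq_abs] at h
    refine h.trans (le_of_eq ?_)
    rw [intervalIntegral.integral_const_mul,
      show (∫ t in (1 / 3 : ℝ)..(1 / 2), (t - 1 / 3)) = 1 / 72 by
        rw [intervalIntegral.integral_sub intervalIntegrable_id intervalIntegrable_const, integral_id,
          intervalIntegral.integral_const]
        norm_num]
    ring
  have hI2 : |∫ x in (1 / 2 : ℝ)..(2 / 3), deriv f x| ≤ A / 72 := by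
    have h := intervalIntegral.norm_integral_le_of_norm_le (f := deriv f) (g := fun t => A * (2 / 3 - t))
      (μ := volume) (by norm_num : (1 / 2 : ℝ) ≤ 2 / 3)
      (Filter.Eventually.of_forall fun t ht => by
        rw [Real.norm_eq_abs]; exact hright t ⟨by linarith [ht.1], ht.2⟩)
      ((continuous_const.mul (continuous_const.sub continuous_id)).intervalIntegrable _ _)
    rw [Real.norm_eq_abs] at h
    refine h.trans (le_of_eq ?_)
    rw [intervalIntegral.integral_const_mul,
      show (∫ t in (1 / 2 : ℝ)..(2 / 3), (2 / 3 - t)) = 1 / 72 by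
        rw [intervalIntegral.integral_sub intervalIntegrable_const intervalIntegrable_id, integral_id,
          intervalIntegral.integral_const]
        norm_num]
    ring
  have hsplit : ∫ x in (1 / 3 : ℝ)..(2 / 3), deriv f x =
      (∫ x in (1 / 3 : ℝ)..(1 / 2), deriv f x) + ∫ x in (1 / 2 : ℝ)..(2 / 3), deriv f x :=
    (integral_add_adjacent_intervals (hint _ _) (hint _ _)).symm
  have hval : ∫ x in (1 / 3 : ℝ)..(2 / 3), deriv f x = -1 := by
    rw [hFTC, h1 (1 / 3) (abs_le.2 ⟨by norm_num, by norm_num⟩), h0 (2 / 3) (le_abs_self _)]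
    norm_num
  have : (1 : ℝ) ≤ A / 72 + A / 72 := by
    calc (1 : ℝ) = |∫ x in (1 / 3 : ℝ)..(2 / 3), deriv f x| := by rw [hval]; norm_num
      _ ≤ |∫ x in (1 / 3 : ℝ)..(1 / 2), deriv f x| + |∫ x in (1 / 2 : ℝ)..(2 / 3), deriv f x| := by
          rw [hsplit]; exact abs_add_le _ _
      _ ≤ A / 72 + A / 72 := add_le_add hI1 hI2
  linarith

/-- Hence the printed «ζ has derivatives up to the second order bounded by 5» fails for EVERY `C²` profile with
the two printed plateaus (in particular for `zeta` above); any `O(1)` replaces it in (3.11)–(3.16).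
[cite: Balaban1987RG1, §3 p.270] -/
theorem not_deriv2_le_five (f : ℝ → ℝ) (hf : ContDiff ℝ 2 f) (h1 : ∀ t, |t| ≤ 1 / 3 → f t = 1)
    (h0 : ∀ t, 2 / 3 ≤ |t| → f t = 0) : ¬ ∀ t, |deriv (deriv f) t| ≤ 5 := by
  intro h
  obtain ⟨t, _, ht⟩ := thirtySix_le_deriv2 f hf h1 h0
  linarith [h t]

/-- In particular for the concrete profile `zeta`: `|ζ″| ≤ 5` fails. [cite: Balaban1987RG1, §3 p.270] -/
theorem zeta_not_deriv2_le_five : ¬ ∀ t, |deriv (deriv zeta) t| ≤ 5 :=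
  not_deriv2_le_five zeta contDiff_zeta (fun _ ht => zeta_eq_one ht) (fun _ ht => zeta_eq_zero ht)

end

end Literature.MathematicalPhysics.QuantumFieldTheory.Balaban1983to89.B12PartitionUnity270
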